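import Summits.QuantumFields.BalabanUV.Beta.HessKerCoDressedWall
import Summits.QuantumFields.BalabanUV.Beta.SpineRootedBm

/-!
# `BalabanUV.Beta.HessKerCoDressedBmWall` — the road-A2 END over the block-mean-dressed rooted literal `SpineRooted.JsBalBmAtOf` and over
# the wall CANDIDATE v2.23 `SpineRooted.JsBalBmAn1At hLc hr` (pending β-lead ruling (R42-1)), SOCKETED ON THE BLOCK-MEAN CO-DRESSED
# RESOLVENTS `coDressKBmAt (toSite r) Lc (KInvStep Lc j)` (asymptotic lane asym1, gen 21, v1; the decl-by-decl twin of `HessKerCoDressedWall`)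

HONEST FRAMING (cell contract, verbatim): «discharging `BetaPertH` makes Bałaban's UV stability UNCONDITIONAL — a real
constructive-QFT result; it is NOT the continuum limit and NOT the Clay problem.»  THIS MODULE is the CONSUMER SOCKET for the block-mean
family.  Lane an2 (NOTE X-an2-42) found the rooted-comb dressing `Π_ρ` of v2.22 dead in mechanism (its coarse pure-gauge defect) and re-typed
the dressing with the BLOCK-MEAN-normalised axial projector kernel `piKBm` (`AxialDressingRootedBmKernel`): `dressKBmAt`, `coDressKBmAt`, the
dressed jets `dressBmAt hr`, the family `SpineRooted.JsBalBmAtOf hLc hr … := dressBmAt hr ∘ JsBal0AtOf hLc hr …` and the coherent candidate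
`SpineRooted.JsBalBmAn1At hLc hr cE cVH cΛ cE₂ cB T` (centred: `JsBalBmAn1AtCtr`), all in the tree; the cell's binder table (row D1) records
«the wall moves to v2.23 = the Π_bm family», ruling (R42-1) PENDING.  an2's DRESSED-KERNEL IDENTITY `AxialDressingRootedBmHessian.TbalOf_dressBmAt`
reads every member of the block-mean family as `hessKer G_j (vertexOfK G_j Lc (JsBal0AtOf … j).S) ((JsBal0AtOf … j).W)` with the CO-DRESSED
resolvent `G_j := AxialDressingRooted.coDressKBmAt (toSite r) Lc (KInvStep Lc j)` (`= piKBmᵀ ∘ K_j ∘ piKBm`, comp form) and the UNDRESSED jets;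
hence (asym1's four-family END `HessKerFourFamily.d1Drift_iff_of_cauchy_four` at that closed form) the candidate wall is equivalent to the
explicit identification under rows asked of the RESCALED CO-DRESSED RESOLVENTS `D_j G_j D_j` and of the UNDRESSED rescaled stencils and tables
(§3–§4) — the typed form of road P4's exit «re-type `hK ∕ hKall` transversally» (`GAN24/MonotoneCoarsenReadOut` reads its contraction out on
`Π_bm`-co-dressed blocks), while road P1's ENTRYWISE rows (`GAN24.CombesThomas.ConvCKWall 3 Lc`) feed the SAME socket through §2 ∕ §5.
Whether Bałaban's `G_j` satisfy the rows is OPEN (G-an2-4).  This module formalises NO statement printed in Bałaban's papers, cites none as a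
hypothesis, mints no `Prop` fact, instantiates NO binder of the wall at a value (RULING (R18-3): root offset, colour weights, position table,
tables, localisation data, unit sequences and every constant stay UNIVERSALLY BOUND) and DISCHARGES NOTHING of it.  v2.23 is a CANDIDATE, not
the wall literal, until (R42-1) is ruled.  NOT summit progress.

ABSOLUTE RULE (cell, verbatim): «No internally-minted statement may enter as a cited fact. Every hypothesis is either
kernel-proved in this package or a verbatim quotation of a PUBLISHED theorem with page reference. The manuscript(s) under
audit are NOT citable for their own disputed steps — they are the thing under adjudication; programme-internal
(2001/route/tribunal) claims are never citable.»  The data binders below are HYPOTHESIS SHAPES with free constants, never asserted.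

PLACEMENT.  Cell result under the registered topic `Summits/QuantumFields/BalabanUV/Beta/` (β-lead (R34-2); < 400 lines; theorems only).

CONTENT (no `def`, no `Prop`; every constant explicit or uniform-existential in `(d, N, δ)` only) — `HessKerCoDressedWall` with `piK ↦ piKBm`,
`coDressKAt ↦ coDressKBmAt`, `cP ↦ cPb`, `TbalOf_dressAt ↦ TbalOf_dressBmAt`, `JsBalAtOf ↦ JsBalBmAtOf`, `JsBalAn1At ↦ JsBalBmAn1At`:
* §1 (any `d`, any root table; `piKBm` is block-diagonal in the leg type): `scaleK_piKBm`, `scaleK_trK_piKBm`, **`unitK_coDressKBmAt`**.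
* §2 (any `d`, in-block root): **`coDressKBmAt_sub`**, **`exists_decays_coDressKBmAt`** (`c(d,N,δ) ≥ 0` with `Decays K C δ → Decays (coDressKBmAt
  (toSite r) N K) (c·C) (δ/4)` for ALL `K`, `C`), **`exists_coDressedBm_rows`**, **`exists_coDressedBm_unit_rows`** (entrywise rows ⟹ co-dressed rows
  at `(c·C, δ/4, c·c_K, θ)`: the K-binders of §3–§4 are IMPLIED by the entrywise ones of `HessKerRootedWall` ∕ `HessKerDressedUnitsWall`).
* §3 (`d = 3`, any in-block root, any tables): **`TbalOf_JsBalBmAtOf_codressedBm(_unit)`**, **`d1Drift_JsBalBmAtOf_iff_of_lim_codressedBm_unit`**,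
  **`d1Drift_JsBalBmAtOf_iff_of_cauchy_codressedBm_unit`**: binder list = `j`-uniform rows + deviations with rate `θ` of `D_j G_j D_j`, of the
  UNDRESSED rescaled rooted stencils `unitS_j (S♭ j)`, of the UNDRESSED rescaled tables `unitW_j (W j)`, windows `0 < R < δK`, `R/2 < δS`,
  `R < δW`, `0 ≤ θ < 1`; conclusion `D1Drift Lc (JsBalBmAtOf …) N μ ν ↔ secondMoment (hessKer G∞ (vertexOfK G∞ Lc S∞) W∞) μ ν = stepBal N Lc`.
* §4 v2.23 CANDIDATE: `JsBalBmAn1At_eq_JsBalBmAtOf` (`rfl`), **`d1Drift_JsBalBmAn1At_iff_of_cauchy_codressedBm_unit`** ((⇐) = `.2`); §5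
  **`d1Drift_JsBalBmAn1At_iff_codressedBm_of_unit_rows`** (the ENTRYWISE `hK ∕ hKall`, window `R < δK/4`, already give the co-dressed
  identification); §6 the CENTRED instance **`d1Drift_JsBalBmAn1AtCtr_iff_of_cauchy_codressedBm_unit`** (root `ctrOff 4 Lc` of an2's `hR` wiring).
WHAT IS NOT HERE: any row for Bałaban's objects; (R42-1); the `hR` ∕ (St♭) ∕ (Wt) side conditions (an2's `SpineRootedBm*`); the identification of
the limit second moment with `stepBal N Lc` (O-asym1-7); `k₀`; `betaPertH_holds`.  NOT continuum, NOT Clay.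
Provenance: pub-balaban β sub-cell, unit b2b-balaban-beta-asym1 gen 21, 2026-08-20 (v1); over an2's `AxialDressingRootedBm{Kernel,Dress,Hessian}`,
`SpineRootedBm` and asym1's `HessKerFourFamily` ∕ `HessKerRootedWall` ∕ `HessKerCoDressedWall` BY NAME; no existing file touched.
-/


open Finset Filter Topology
open scoped BigOperators
open Literature.MathematicalPhysics.QuantumFieldTheory.Balaban1983to89
open Literature.MathematicalPhysics.QuantumFieldTheory.Balaban1983to89.Beta
open ExpKernelCalculus (MKer Decays BiLoc VertexFamily₂ hessKer comp Zl Zl_nonneg)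
open HessKerRate (scaleK scaleK_apply comp_scaleK)
open AffineAveraging (Form1 box toSite)
open AveragingContoursRooted (ctrOff ctrOff_mem_box)
open OneStepResolventKernel (Fib LocStencil JetData)
open OneStepKernelFamily (vertexOfK KInvStep TbalOf D1Drift)
open HessKerDressedLimit (limMKerOf limStOf limTabOf decays_limMKerOf decays_sub_limMKerOf locStencil_limStOf locStencil_sub_limStOf
  vertexFamily₂_limTabOf vertexFamily₂_sub_limTabOf)
open Summit.QuantumFields.BalabanUV.Beta.TameKernelCalculus (Spr trK trK_apply decays_trK comp_sub_right_tame comp_sub_left_tame)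
open Summit.QuantumFields.BalabanUV.Beta.HessKerDressedUnits
open Summit.QuantumFields.BalabanUV.Beta.HessKerFourFamily (hessKer_four_unit d1Drift_iff_of_lim_four)
open Summit.QuantumFields.BalabanUV.Beta.AxialDressingRooted (piKBm piKBm_inl_inl piKBm_inl_inr piKBm_inr_inl piKBm_inr_inr cPb cPb_nonneg
  decays_piKBm spr_piKBm spr_trK_piKBm spr_comp coDressKBmAt coDressKBmAt_eq dressBmAt TbalOf_dressBmAt)
open Summit.QuantumFields.BalabanUV.Beta.SpineRooted (JsBal0AtOf JsBal0AtOf_W JsBalBmAtOf JsBalBmAn1At JsBalBmAn1AtCtr JsBalBmAn1AtCtr_eq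
  WbalAtOf T2AtOf T2AtOf_loc CwAtOf δwAtOf δwAtOf_pos WbalAtOf_loc₂)
open Summit.QuantumFields.BalabanUV.Beta.HessKerRootedWall (JsBal0AtOf_S_indep)
open AveragingMixedJetTables (vh₂SAt mixFFAt)
open Summit.QuantumFields.BalabanUV.Beta.MixedJetTablesPlug (hB_an1 hmix_an1)

namespace Summit.QuantumFields.BalabanUV.Beta.HessKerCoDressedBmWall

noncomputable section

/-! ## §1 Leg-type-constant units commute with the block-mean co-dressing -/

section Units

variable {d : ℕ} (ρ : Fin (d + 1) → ℤ) (N : ℕ) {sf sm : ℝ}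

/-- [folklore] The block-mean projector kernel is block-diagonal in the leg type, so `D⁻¹ · piKBm · D = piKBm` for leg-type-constant units
`D = diag(s_f ∣ s_m)`. -/
theorem scaleK_piKBm (hsf : sf ≠ 0) (hsm : sm ≠ 0) :
    scaleK (legScale sf⁻¹ sm⁻¹) (legScale sf sm) (piKBm ρ N) = piKBm ρ N := by
  funext x x' a b
  rcases a with α | m <;> rcases b with β | m'
  · rw [scaleK_apply, legScale_inl, legScale_inl, mul_comm, ← mul_assoc, mul_inv_cancel₀ hsf, one_mul]
  · rw [scaleK_apply, piKBm_inl_inr, mul_zero, zero_mul]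
  · rw [scaleK_apply, piKBm_inr_inl, mul_zero, zero_mul]
  · rw [scaleK_apply, legScale_inr, legScale_inr, mul_comm, ← mul_assoc, mul_inv_cancel₀ hsm, one_mul]

/-- [folklore] … and `D · piKBmᵀ · D⁻¹ = piKBmᵀ`. -/
theorem scaleK_trK_piKBm (hsf : sf ≠ 0) (hsm : sm ≠ 0) :
    scaleK (legScale sf sm) (legScale sf⁻¹ sm⁻¹) (trK (piKBm ρ N)) = trK (piKBm ρ N) := by
  funext x x' a b
  rcases a with α | m <;> rcases b with β | m'
  · rw [scaleK_apply, trK_apply, legScale_inl, legScale_inl, mul_comm, ← mul_assoc, inv_mul_cancel₀ hsf, one_mul]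
  · rw [scaleK_apply, trK_apply, piKBm_inr_inl, mul_zero, zero_mul]
  · rw [scaleK_apply, trK_apply, piKBm_inl_inr, mul_zero, zero_mul]
  · rw [scaleK_apply, trK_apply, legScale_inr, legScale_inr, mul_comm, ← mul_assoc, inv_mul_cancel₀ hsm, one_mul]

/-- [folklore] **LEG UNITS COMMUTE WITH THE BLOCK-MEAN CO-DRESSING**: `unitK s_f s_m (coDressKBmAt ρ N K) = coDressKBmAt ρ N (unitK s_f s_m K)`
for nonzero leg-type-constant units (`HessKerRate.comp_scaleK` twice: the inner units cancel). -/
theorem unitK_coDressKBmAt (hsf : sf ≠ 0) (hsm : sm ≠ 0) (K : MKer (d + 1) (Fib d)) :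
    unitK sf sm (coDressKBmAt ρ N K) = coDressKBmAt ρ N (unitK sf sm K) := by
  have hinv : ∀ f : Fib d, legScale sf⁻¹ sm⁻¹ f * legScale sf sm f = 1 := legScale_inv_mul_legScale hsf hsm
  have hmul : ∀ f : Fib d, legScale sf sm f * legScale sf⁻¹ sm⁻¹ f = 1 := legScale_mul_legScale_inv hsf hsm
  rw [coDressKBmAt_eq, coDressKBmAt_eq]
  show scaleK (legScale sf sm) (legScale sf sm) (comp (comp (trK (piKBm ρ N)) K) (piKBm ρ N)) =
    comp (comp (trK (piKBm ρ N)) (scaleK (legScale sf sm) (legScale sf sm) K)) (piKBm ρ N)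
  symm
  calc comp (comp (trK (piKBm ρ N)) (scaleK (legScale sf sm) (legScale sf sm) K)) (piKBm ρ N)
      = comp (comp (scaleK (legScale sf sm) (legScale sf⁻¹ sm⁻¹) (trK (piKBm ρ N))) (scaleK (legScale sf sm) (legScale sf sm) K))
          (scaleK (legScale sf⁻¹ sm⁻¹) (legScale sf sm) (piKBm ρ N)) := by rw [scaleK_trK_piKBm ρ N hsf hsm, scaleK_piKBm ρ N hsf hsm]
    _ = comp (scaleK (legScale sf sm) (legScale sf sm) (comp (trK (piKBm ρ N)) K)) (scaleK (legScale sf⁻¹ sm⁻¹) (legScale sf sm) (piKBm ρ N)) := by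
          rw [comp_scaleK _ _ _ _ hinv]
    _ = scaleK (legScale sf sm) (legScale sf sm) (comp (comp (trK (piKBm ρ N)) K) (piKBm ρ N)) := comp_scaleK _ _ _ _ hmul _ _

end Units

/-! ## §2 Additivity and an explicit-uniform decay transport for the block-mean co-dressing; family rows transfer -/

section Transport

variable {d : ℕ} {N : ℕ} (hN : 1 ≤ N) {r : Fin (d + 1) → ℕ} (hr : r ∈ box (d + 1) N)
include hN hr

/-- [folklore] **THE BLOCK-MEAN CO-DRESSING IS ADDITIVE ON SPREAD KERNELS** (in-block root):
`coDressKBmAt (K − K′) = coDressKBmAt K − coDressKBmAt K′` (an5's tame composition calculus; the series converge absolutely). -/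
theorem coDressKBmAt_sub {K K' : MKer (d + 1) (Fib d)} (hK : Spr K) (hK' : Spr K') :
    coDressKBmAt (toSite r) N (K - K') = coDressKBmAt (toSite r) N K - coDressKBmAt (toSite r) N K' := by
  have sPt : Spr (trK (piKBm (toSite r) N)) := spr_trK_piKBm hN hr
  have sP : Spr (piKBm (toSite r) N) := spr_piKBm hN hr
  rw [coDressKBmAt_eq, coDressKBmAt_eq, coDressKBmAt_eq, comp_sub_right_tame sPt.tame hK.tame hK'.tame,
    comp_sub_left_tame (spr_comp sPt hK).tame (spr_comp sPt hK').tame sP.tame]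

/-- [folklore] **EXPLICIT-UNIFORM DECAY TRANSPORT THROUGH THE BLOCK-MEAN CO-DRESSING**: for every `δ > 0` the constant
`c = |Fib d|²·cPb(δ)·cPb(δ/2)·Zl(δ/2)·Zl(δ/4) ≥ 0` gives `Decays K C δ → Decays (coDressKBmAt (toSite r) N K) (c·C) (δ/4)` for ALL `K`, `C`
(`decays_piKBm` at every rate, `BalabanStepJetsSucc.decays_comp` twice — an2's `decays_coDressKBmAt` with the constant made uniform). -/
theorem exists_decays_coDressKBmAt {δ : ℝ} (hδ : 0 < δ) :
    ∃ c : ℝ, 0 ≤ c ∧ ∀ (K : MKer (d + 1) (Fib d)) (C : ℝ), Decays K C δ → Decays (coDressKBmAt (toSite r) N K) (c * C) (δ / 4) := by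
  refine ⟨(Fintype.card (Fib d) : ℝ) ^ 2 * (cPb d N δ * cPb d N (δ / 2)) * (Zl (d + 1) (δ / 2) * Zl (d + 1) (δ / 4)),
    mul_nonneg (mul_nonneg (pow_nonneg (Nat.cast_nonneg _) 2) (mul_nonneg (cPb_nonneg d N δ) (cPb_nonneg d N (δ / 2))))
      (mul_nonneg (Zl_nonneg (by linarith)) (Zl_nonneg (by linarith))), fun K C hK => ?_⟩
  have hPt : Decays (trK (piKBm (toSite r) N)) (cPb d N δ) δ := decays_trK (decays_piKBm hN hr hδ.le)
  have h1 := BalabanStepJetsSucc.decays_comp hPt hK (show (0 : ℝ) ≤ δ / 2 by linarith) (show δ / 2 < δ by linarith)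
  rw [show δ - δ / 2 = δ / 2 by ring] at h1
  have hP : Decays (piKBm (toSite r) N) (cPb d N (δ / 2)) (δ / 2) := decays_piKBm hN hr (by linarith)
  have h2 := BalabanStepJetsSucc.decays_comp h1 hP (show (0 : ℝ) ≤ δ / 4 by linarith) (show δ / 4 < δ / 2 by linarith)
  rw [show δ / 2 - δ / 4 = δ / 4 by ring] at h2
  rw [coDressKBmAt_eq]
  exact OneStepResolventKernel.decays_mono h2 (h2.nonneg (Sum.inl 0)) (le_of_eq (by ring)) le_rfl

/-- [folklore] **FAMILY ROWS TRANSFER TO THE BLOCK-MEAN CO-DRESSED FAMILY, CAUCHY CURRENCY**: `j`-uniform rows and all-scales deviations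
(`δK > 0`) of `K` give those of `j ↦ coDressKBmAt (toSite r) N (K j)` at `(c·C, δK/4)` and `(c·c_K·θ^k, δK/4)`, `c = c(d,N,δK)`. -/
theorem exists_coDressedBm_rows {K : ℕ → MKer (d + 1) (Fib d)} {C cK δK θ : ℝ} (hδK : 0 < δK) (hK : ∀ j, Decays (K j) C δK)
    (hKall : ∀ k j, Decays (K (k + j) - K k) (cK * θ ^ k) δK) :
    ∃ c : ℝ, 0 ≤ c ∧ (∀ j, Decays (coDressKBmAt (toSite r) N (K j)) (c * C) (δK / 4)) ∧
      ∀ k j, Decays (coDressKBmAt (toSite r) N (K (k + j)) - coDressKBmAt (toSite r) N (K k)) (c * cK * θ ^ k) (δK / 4) := by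
  obtain ⟨c, hc0, hc⟩ := exists_decays_coDressKBmAt hN hr hδK
  refine ⟨c, hc0, fun j => hc _ _ (hK j), fun k j => ?_⟩
  rw [← coDressKBmAt_sub hN hr ⟨C, δK, hδK, hK (k + j)⟩ ⟨C, δK, hδK, hK k⟩, mul_assoc]
  exact hc _ _ (hKall k j)

/-- [folklore] **RESCALED FAMILY ROWS TRANSFER TO THE RESCALED BLOCK-MEAN CO-DRESSED FAMILY** (nonzero leg units, `unitK_coDressKBmAt`): rows and
all-scales deviations of `D_j K_j D_j` give those of `D_j (coDressKBmAt (toSite r) N K_j) D_j` at `(c·C, δK/4, c·c_K, θ)`. -/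
theorem exists_coDressedBm_unit_rows (sf sm : ℕ → ℝ) (hsf : ∀ j, sf j ≠ 0) (hsm : ∀ j, sm j ≠ 0) {K : ℕ → MKer (d + 1) (Fib d)}
    {C cK δK θ : ℝ} (hδK : 0 < δK) (hK : ∀ j, Decays (unitK (sf j) (sm j) (K j)) C δK)
    (hKall : ∀ k j, Decays (unitK (sf (k + j)) (sm (k + j)) (K (k + j)) - unitK (sf k) (sm k) (K k)) (cK * θ ^ k) δK) :
    ∃ c : ℝ, 0 ≤ c ∧ (∀ j, Decays (unitK (sf j) (sm j) (coDressKBmAt (toSite r) N (K j))) (c * C) (δK / 4)) ∧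
      ∀ k j, Decays (unitK (sf (k + j)) (sm (k + j)) (coDressKBmAt (toSite r) N (K (k + j))) -
        unitK (sf k) (sm k) (coDressKBmAt (toSite r) N (K k))) (c * cK * θ ^ k) (δK / 4) := by
  obtain ⟨c, hc0, h1, h2⟩ := exists_coDressedBm_rows hN hr (K := fun j => unitK (sf j) (sm j) (K j)) hδK hK hKall
  refine ⟨c, hc0, fun j => ?_, fun k j => ?_⟩
  · rw [unitK_coDressKBmAt _ _ (hsf j) (hsm j)]
    exact h1 j
  · rw [unitK_coDressKBmAt _ _ (hsf (k + j)) (hsm (k + j)), unitK_coDressKBmAt _ _ (hsf k) (hsm k)]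
    exact h2 k j

end Transport

/-! ## §3 Dimension four: the END over the block-mean-dressed rooted literal `SpineRooted.JsBalBmAtOf` on the CO-DRESSED resolvents -/

section End

variable {Lc : ℕ} [NeZero Lc] (hLc : 1 ≤ Lc) {r : Fin (3 + 1) → ℕ} (hr : r ∈ box (3 + 1) Lc) (cE cVH cΛ : ℝ)
  (W : ℕ → Fin (3 + 1) → (Fin (3 + 1) → ℤ) → Fin (3 + 1) → (Fin (3 + 1) → ℤ) → MKer (3 + 1) (Fib 3))
  (Cw' δw : ℕ → ℝ) (hδw : ∀ j, 0 < δw j) (hW' : ∀ j, VertexFamily₂ (W j) Lc (Cw' j) (δw j))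
  (Sfl : ℕ → Fin (3 + 1) → (Fin (3 + 1) → ℤ) → MKer (3 + 1) (Fib 3)) (sf sm : ℕ → ℝ)
  {Ginf : MKer (3 + 1) (Fib 3)} {Sinf : Fin (3 + 1) → (Fin (3 + 1) → ℤ) → MKer (3 + 1) (Fib 3)}
  {Winf : Fin (3 + 1) → (Fin (3 + 1) → ℤ) → Fin (3 + 1) → (Fin (3 + 1) → ℤ) → MKer (3 + 1) (Fib 3)}
  {R C cK δK Cs cS δS Cw cW δW θ : ℝ}

/-- [folklore] **an2's BLOCK-MEAN DRESSED-KERNEL IDENTITY ON A PRESENTATION `S♭` OF THE UNDRESSED STENCILS**: `TbalOf Lc (JsBalBmAtOf …) j =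
hessKer G_j (vertexOfK G_j Lc (S♭ j)) (W j)`, `G_j = coDressKBmAt (toSite r) Lc (KInvStep Lc j)` (`TbalOf_dressBmAt`, `rfl`, `JsBal0AtOf_W`). -/
theorem TbalOf_JsBalBmAtOf_codressedBm (hSfl : ∀ j, (JsBal0AtOf hLc hr cE cVH cΛ W Cw' δw hδw hW' j).S = Sfl j) (j : ℕ) :
    TbalOf Lc (JsBalBmAtOf hLc hr cE cVH cΛ W Cw' δw hδw hW') j =
      hessKer (coDressKBmAt (toSite r) Lc (KInvStep (d := 3) Lc j))
        (vertexOfK (coDressKBmAt (toSite r) Lc (KInvStep (d := 3) Lc j)) Lc (Sfl j)) (W j) := by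
  have h := TbalOf_dressBmAt hr (JsBal0AtOf hLc hr cE cVH cΛ W Cw' δw hδw hW') j
  rw [hSfl j, JsBal0AtOf_W] at h; exact h

/-- [folklore] **THE SAME IN ANY NONZERO LEG UNITS, AS A FOUR-FAMILY FORM ON `D_j G_j D_j`** (`HessKerFourFamily.hessKer_four_unit`);
NO dressing of the rescaled stencils / tables. -/
theorem TbalOf_JsBalBmAtOf_codressedBm_unit (hSfl : ∀ j, (JsBal0AtOf hLc hr cE cVH cΛ W Cw' δw hδw hW' j).S = Sfl j)
    (hsf : ∀ j, sf j ≠ 0) (hsm : ∀ j, sm j ≠ 0) (j : ℕ) :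
    TbalOf Lc (JsBalBmAtOf hLc hr cE cVH cΛ W Cw' δw hδw hW') j =
      hessKer (unitK (sf j) (sm j) (coDressKBmAt (toSite r) Lc (KInvStep (d := 3) Lc j)))
        (vertexOfK (unitK (sf j) (sm j) (coDressKBmAt (toSite r) Lc (KInvStep (d := 3) Lc j))) Lc (unitS (sf j) (sm j) (Sfl j)))
        (unitW (sf j) (sm j) (W j)) := by
  rw [TbalOf_JsBalBmAtOf_codressedBm hLc hr cE cVH cΛ W Cw' δw hδw hW' Sfl hSfl j]
  exact (hessKer_four_unit (hsf j) (hsm j) Lc _ _ (Sfl j) (W j)).symm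

/-- [folklore] **THE BLOCK-MEAN FAMILY'S WALL ⟺ THE EXPLICIT IDENTIFICATION, LIMIT CURRENCY, CO-DRESSED K-SLOT, ANY UNITS**: rows and
deviations with rate `θ` of `D_j G_j D_j`, of `unitS_j (S♭ j)`, of `unitW_j (W j)` against named limits `(G∞, S∞, W∞)`, `0 ≤ θ < 1` ⟹
`D1Drift Lc (JsBalBmAtOf …) N μ ν ↔ secondMoment (hessKer G∞ (vertexOfK G∞ Lc S∞) W∞) μ ν = stepBal N Lc`.  Discharges NOTHING. -/
theorem d1Drift_JsBalBmAtOf_iff_of_lim_codressedBm_unit (hSfl : ∀ j, (JsBal0AtOf hLc hr cE cVH cΛ W Cw' δw hδw hW' j).S = Sfl j)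
    (hsf : ∀ j, sf j ≠ 0) (hsm : ∀ j, sm j ≠ 0)
    (hG : ∀ j, Decays (unitK (sf j) (sm j) (coDressKBmAt (toSite r) Lc (KInvStep (d := 3) Lc j))) C δK) (hGinf : Decays Ginf C δK)
    (hGrate : ∀ j, Decays (unitK (sf j) (sm j) (coDressKBmAt (toSite r) Lc (KInvStep (d := 3) Lc j)) - Ginf) (cK * θ ^ j) δK)
    (hS : ∀ j, LocStencil (unitS (sf j) (sm j) (Sfl j)) Cs δS) (hSinf : LocStencil Sinf Cs δS)
    (hSrate : ∀ j, LocStencil (unitS (sf j) (sm j) (Sfl j) - Sinf) (cS * θ ^ j) δS)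
    (hW : ∀ j, VertexFamily₂ (unitW (sf j) (sm j) (W j)) Lc Cw δW) (hWinf : VertexFamily₂ Winf Lc Cw δW)
    (hWrate : ∀ j, VertexFamily₂ (unitW (sf j) (sm j) (W j) - Winf) Lc (cW * θ ^ j) δW)
    (hR : 0 < R) (hRK : R < δK) (hRS : R / 2 < δS) (hRW : R < δW) (hθ0 : 0 ≤ θ) (hθ1 : θ < 1) (μ ν : Fin 4) (N : ℝ) :
    D1Drift Lc (JsBalBmAtOf hLc hr cE cVH cΛ W Cw' δw hδw hW') N μ ν ↔
      B12Beta.secondMoment (hessKer Ginf (vertexOfK Ginf Lc Sinf) Winf) μ ν = B12Normalization.stepBal N Lc :=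
  d1Drift_iff_of_lim_four (JsBalBmAtOf hLc hr cE cVH cΛ W Cw' δw hδw hW')
    (A := fun j => unitK (sf j) (sm j) (coDressKBmAt (toSite r) Lc (KInvStep (d := 3) Lc j)))
    (K := fun j => unitK (sf j) (sm j) (coDressKBmAt (toSite r) Lc (KInvStep (d := 3) Lc j)))
    (S := fun j => unitS (sf j) (sm j) (Sfl j)) (W := fun j => unitW (sf j) (sm j) (W j)) (Ainf := Ginf) (Kinf := Ginf) (Sinf := Sinf)
    (Winf := Winf) (TbalOf_JsBalBmAtOf_codressedBm_unit hLc hr cE cVH cΛ W Cw' δw hδw hW' Sfl sf sm hSfl hsf hsm) hG hGinf hGrate hG hGinf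
    hGrate hS hSinf hSrate hW hWinf hWrate hR hRK hRS hRW hθ0 hθ1 μ ν N

/-- [folklore] **THE BLOCK-MEAN FAMILY'S WALL ⟺ THE EXPLICIT IDENTIFICATION AT THE CONSTRUCTED LIMITS, CAUCHY CURRENCY, CO-DRESSED K-SLOT, ANY
UNITS**: `j`-uniform rows + ALL-SCALES deviations with rate `θ` of `D_j G_j D_j` (`G_j = coDressKBmAt (toSite r) Lc (KInvStep Lc j)`), of
`unitS_j (S♭ j)`, of `unitW_j (W j)`, `0 ≤ θ < 1` ⟹ the wall `↔` the identification at `G∞ = limMKerOf (D G D)`, `S∞ = limStOf (unitS S♭)`,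
`W∞ = limTabOf (unitW W)` (the binder list of `HessKerCoDressedWall.d1Drift_JsBalAtOf_iff_of_cauchy_codressed_unit` with `coDressKAt ↦ coDressKBmAt`).
NOT proved here for Bałaban's objects; discharges NOTHING. -/
theorem d1Drift_JsBalBmAtOf_iff_of_cauchy_codressedBm_unit (hSfl : ∀ j, (JsBal0AtOf hLc hr cE cVH cΛ W Cw' δw hδw hW' j).S = Sfl j)
    (hsf : ∀ j, sf j ≠ 0) (hsm : ∀ j, sm j ≠ 0)
    (hG : ∀ j, Decays (unitK (sf j) (sm j) (coDressKBmAt (toSite r) Lc (KInvStep (d := 3) Lc j))) C δK)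
    (hGall : ∀ k j, Decays (unitK (sf (k + j)) (sm (k + j)) (coDressKBmAt (toSite r) Lc (KInvStep (d := 3) Lc (k + j))) -
      unitK (sf k) (sm k) (coDressKBmAt (toSite r) Lc (KInvStep (d := 3) Lc k))) (cK * θ ^ k) δK)
    (hS : ∀ j, LocStencil (unitS (sf j) (sm j) (Sfl j)) Cs δS)
    (hSall : ∀ k j, LocStencil (unitS (sf (k + j)) (sm (k + j)) (Sfl (k + j)) - unitS (sf k) (sm k) (Sfl k)) (cS * θ ^ k) δS)
    (hW : ∀ j, VertexFamily₂ (unitW (sf j) (sm j) (W j)) Lc Cw δW)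
    (hWall : ∀ k j, VertexFamily₂ (unitW (sf (k + j)) (sm (k + j)) (W (k + j)) - unitW (sf k) (sm k) (W k)) Lc (cW * θ ^ k) δW)
    (hR : 0 < R) (hRK : R < δK) (hRS : R / 2 < δS) (hRW : R < δW) (hθ0 : 0 ≤ θ) (hθ1 : θ < 1) (μ ν : Fin 4) (N : ℝ) :
    D1Drift Lc (JsBalBmAtOf hLc hr cE cVH cΛ W Cw' δw hδw hW') N μ ν ↔
      B12Beta.secondMoment (hessKer (limMKerOf fun j => unitK (sf j) (sm j) (coDressKBmAt (toSite r) Lc (KInvStep (d := 3) Lc j)))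
        (vertexOfK (limMKerOf fun j => unitK (sf j) (sm j) (coDressKBmAt (toSite r) Lc (KInvStep (d := 3) Lc j))) Lc
          (limStOf fun j => unitS (sf j) (sm j) (Sfl j)))
        (limTabOf fun j => unitW (sf j) (sm j) (W j))) μ ν = B12Normalization.stepBal N Lc :=
  d1Drift_JsBalBmAtOf_iff_of_lim_codressedBm_unit hLc hr cE cVH cΛ W Cw' δw hδw hW' Sfl sf sm
    (Ginf := limMKerOf fun j => unitK (sf j) (sm j) (coDressKBmAt (toSite r) Lc (KInvStep (d := 3) Lc j)))
    (Sinf := limStOf fun j => unitS (sf j) (sm j) (Sfl j)) (Winf := limTabOf fun j => unitW (sf j) (sm j) (W j)) hSfl hsf hsm hG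
    (decays_limMKerOf hG hGall hθ1) (decays_sub_limMKerOf hGall hθ1) hS (locStencil_limStOf hS hSall hθ1) (locStencil_sub_limStOf hSall hθ1) hW
    (vertexFamily₂_limTabOf hW hWall hθ1) (vertexFamily₂_sub_limTabOf hWall hθ1) hR hRK hRS hRW hθ0 hθ1 μ ν N

end End

/-! ## §4 The wall CANDIDATE v2.23 `SpineRooted.JsBalBmAn1At hLc hr` (pending (R42-1)) on the block-mean co-dressed resolvents -/

section WallV223

variable {Lc : ℕ} [NeZero Lc] (hLc : 1 ≤ Lc) {r : Fin (3 + 1) → ℕ} (hr : r ∈ box (3 + 1) Lc) (cE cVH cΛ cE₂ cB : ℝ)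
  (T : Fin 4 → Fin 4 → Fin 4 → Fin 4 → ℝ)

/-- [folklore] **v2.23 IS `JsBalBmAtOf` AT THE RECURSIVE TABLES** (`rfl`; twin of `HessKerRootedWall.JsBalAn1At_eq_JsBalAtOf`). -/
theorem JsBalBmAn1At_eq_JsBalBmAtOf :
    JsBalBmAn1At hLc hr cE cVH cΛ cE₂ cB T =
      JsBalBmAtOf hLc hr cE cVH cΛ (WbalAtOf 3 Lc (toSite r) cE cVH cΛ
          (T2AtOf 3 Lc (toSite r) cE cVH cΛ cE₂ cB T (vh₂SAt (toSite r) Lc) (mixFFAt (toSite r) Lc)) (mixFFAt (toSite r) Lc))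
        (CwAtOf hLc hr cE cVH cΛ (T2AtOf_loc hLc hr cE cVH cΛ cE₂ cB T (hB_an1 hLc hr) (hmix_an1 hLc hr)) (hmix_an1 hLc hr))
        (δwAtOf hLc hr cE cVH cΛ (T2AtOf_loc hLc hr cE cVH cΛ cE₂ cB T (hB_an1 hLc hr) (hmix_an1 hLc hr)) (hmix_an1 hLc hr))
        (δwAtOf_pos hLc hr cE cVH cΛ (T2AtOf_loc hLc hr cE cVH cΛ cE₂ cB T (hB_an1 hLc hr) (hmix_an1 hLc hr)) (hmix_an1 hLc hr))
        (WbalAtOf_loc₂ hLc hr cE cVH cΛ (T2AtOf_loc hLc hr cE cVH cΛ cE₂ cB T (hB_an1 hLc hr) (hmix_an1 hLc hr)) (hmix_an1 hLc hr)) :=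
  rfl

variable (Sfl : ℕ → Fin (3 + 1) → (Fin (3 + 1) → ℤ) → MKer (3 + 1) (Fib 3))
  (Wfl : ℕ → Fin (3 + 1) → (Fin (3 + 1) → ℤ) → Fin (3 + 1) → (Fin (3 + 1) → ℤ) → MKer (3 + 1) (Fib 3)) (sf sm : ℕ → ℝ)
  {W₀ : ℕ → Fin (3 + 1) → (Fin (3 + 1) → ℤ) → Fin (3 + 1) → (Fin (3 + 1) → ℤ) → MKer (3 + 1) (Fib 3)} {Cw₀ δw₀ : ℕ → ℝ}
  {hδw₀ : ∀ j, 0 < δw₀ j} {hW₀ : ∀ j, VertexFamily₂ (W₀ j) Lc (Cw₀ j) (δw₀ j)} {R C cK δK Cs cS δS Cw cW δW θ : ℝ}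
  (hSfl : ∀ j, (JsBal0AtOf hLc hr cE cVH cΛ W₀ Cw₀ δw₀ hδw₀ hW₀ j).S = Sfl j)
  (hWfl : ∀ j, WbalAtOf 3 Lc (toSite r) cE cVH cΛ
    (T2AtOf 3 Lc (toSite r) cE cVH cΛ cE₂ cB T (vh₂SAt (toSite r) Lc) (mixFFAt (toSite r) Lc)) (mixFFAt (toSite r) Lc) j = Wfl j)
  (hsf : ∀ j, sf j ≠ 0) (hsm : ∀ j, sm j ≠ 0)
include hSfl hWfl hsf hsm

/-- [folklore] **THE WALL CANDIDATE v2.23 ⟺ THE EXPLICIT IDENTIFICATION AT THE CONSTRUCTED LIMITS, CAUCHY CURRENCY, BLOCK-MEAN CO-DRESSED K-SLOT,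
ANY UNITS** — §3's END at v2.23's instance (`JsBalBmAn1At_eq_JsBalBmAtOf`, `rfl`), for ANY presentations `S♭` of the undressed rooted stencils
(`hS♭`, against ANY table data: `JsBal0AtOf_S_indep`) and `W♭` of the tables `W♮ j := WbalAtOf 3 Lc (toSite r) … (T2AtOf …) (mixFFAt (toSite r) Lc) j`
(`hW♭`): `j`-uniform rows + ALL-SCALES deviations with rate `θ` of `D_j (coDressKBmAt (toSite r) Lc K_j) D_j`, of `unitS_j (S♭ j)`, of
`unitW_j (W♭ j)`, `0 ≤ θ < 1` ⟹ `D1Drift Lc (JsBalBmAn1At hLc hr …) N μ ν ↔ secondMoment (hessKer G∞ (vertexOfK G∞ Lc S∞) W∞) μ ν = stepBal N Lc`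
at the constructed limits.  Instantiates no binder at a value; discharges NOTHING (whether Bałaban's block-mean co-dressed resolvents satisfy the
K-rows is OPEN — G-an2-4, roads P1 ∕ P4; the identification is O-asym1-7; v2.23 itself is pending (R42-1)). -/
theorem d1Drift_JsBalBmAn1At_iff_of_cauchy_codressedBm_unit
    (hG : ∀ j, Decays (unitK (sf j) (sm j) (coDressKBmAt (toSite r) Lc (KInvStep (d := 3) Lc j))) C δK)
    (hGall : ∀ k j, Decays (unitK (sf (k + j)) (sm (k + j)) (coDressKBmAt (toSite r) Lc (KInvStep (d := 3) Lc (k + j))) -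
      unitK (sf k) (sm k) (coDressKBmAt (toSite r) Lc (KInvStep (d := 3) Lc k))) (cK * θ ^ k) δK)
    (hS : ∀ j, LocStencil (unitS (sf j) (sm j) (Sfl j)) Cs δS)
    (hSall : ∀ k j, LocStencil (unitS (sf (k + j)) (sm (k + j)) (Sfl (k + j)) - unitS (sf k) (sm k) (Sfl k)) (cS * θ ^ k) δS)
    (hW : ∀ j, VertexFamily₂ (unitW (sf j) (sm j) (Wfl j)) Lc Cw δW)
    (hWall : ∀ k j, VertexFamily₂ (unitW (sf (k + j)) (sm (k + j)) (Wfl (k + j)) - unitW (sf k) (sm k) (Wfl k)) Lc (cW * θ ^ k) δW)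
    (hR : 0 < R) (hRK : R < δK) (hRS : R / 2 < δS) (hRW : R < δW) (hθ0 : 0 ≤ θ) (hθ1 : θ < 1) (μ ν : Fin 4) (N : ℝ) :
    D1Drift Lc (JsBalBmAn1At hLc hr cE cVH cΛ cE₂ cB T) N μ ν ↔
      B12Beta.secondMoment (hessKer (limMKerOf fun j => unitK (sf j) (sm j) (coDressKBmAt (toSite r) Lc (KInvStep (d := 3) Lc j)))
        (vertexOfK (limMKerOf fun j => unitK (sf j) (sm j) (coDressKBmAt (toSite r) Lc (KInvStep (d := 3) Lc j))) Lc
          (limStOf fun j => unitS (sf j) (sm j) (Sfl j)))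
        (limTabOf fun j => unitW (sf j) (sm j) (Wfl j))) μ ν = B12Normalization.stepBal N Lc := by
  obtain rfl : WbalAtOf 3 Lc (toSite r) cE cVH cΛ
      (T2AtOf 3 Lc (toSite r) cE cVH cΛ cE₂ cB T (vh₂SAt (toSite r) Lc) (mixFFAt (toSite r) Lc)) (mixFFAt (toSite r) Lc) = Wfl :=
    funext hWfl
  rw [JsBalBmAn1At_eq_JsBalBmAtOf]
  refine d1Drift_JsBalBmAtOf_iff_of_cauchy_codressedBm_unit hLc hr cE cVH cΛ _ _ _ _ _ Sfl sf sm (fun j => ?_) hsf hsm hG hGall hS hSall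
    hW hWall hR hRK hRS hRW hθ0 hθ1 μ ν N
  exact (JsBal0AtOf_S_indep hLc hr cE cVH cΛ j).trans (hSfl j)

/-! ## §5 Consistency with the entrywise K-rows of `HessKerRootedWall` ∕ `HessKerDressedUnitsWall` -/

/-- [folklore] **THE ENTRYWISE K-ROWS ALREADY GIVE THE BLOCK-MEAN CO-DRESSED IDENTIFICATION** (window `R < δK/4`): rows of the RESCALED
DECIMATED WEAK-LANDAU RESOLVENTS `D_j K_j D_j` themselves (the K-binders of `HessKerRootedWall.d1Drift_JsBalAn1At_iff_of_cauchy_unit`, the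
currency of `GAN24.CombesThomas.ConvCKWall 3 Lc`) give §4's co-dressed K-rows at `(c·C, δK/4, c·c_K, θ)` (`exists_coDressedBm_unit_rows`), hence
the wall `↔` the identification at the BLOCK-MEAN CO-DRESSED constructed limit.  (Weaker-or-equal; strictly weaker is not claimed.) -/
theorem d1Drift_JsBalBmAn1At_iff_codressedBm_of_unit_rows
    (hK : ∀ j, Decays (unitK (sf j) (sm j) (KInvStep (d := 3) Lc j)) C δK)
    (hKall : ∀ k j, Decays (unitK (sf (k + j)) (sm (k + j)) (KInvStep (d := 3) Lc (k + j)) -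
      unitK (sf k) (sm k) (KInvStep (d := 3) Lc k)) (cK * θ ^ k) δK)
    (hS : ∀ j, LocStencil (unitS (sf j) (sm j) (Sfl j)) Cs δS)
    (hSall : ∀ k j, LocStencil (unitS (sf (k + j)) (sm (k + j)) (Sfl (k + j)) - unitS (sf k) (sm k) (Sfl k)) (cS * θ ^ k) δS)
    (hW : ∀ j, VertexFamily₂ (unitW (sf j) (sm j) (Wfl j)) Lc Cw δW)
    (hWall : ∀ k j, VertexFamily₂ (unitW (sf (k + j)) (sm (k + j)) (Wfl (k + j)) - unitW (sf k) (sm k) (Wfl k)) Lc (cW * θ ^ k) δW)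
    (hR : 0 < R) (hRK : R < δK / 4) (hRS : R / 2 < δS) (hRW : R < δW) (hθ0 : 0 ≤ θ) (hθ1 : θ < 1) (μ ν : Fin 4) (N : ℝ) :
    D1Drift Lc (JsBalBmAn1At hLc hr cE cVH cΛ cE₂ cB T) N μ ν ↔
      B12Beta.secondMoment (hessKer (limMKerOf fun j => unitK (sf j) (sm j) (coDressKBmAt (toSite r) Lc (KInvStep (d := 3) Lc j)))
        (vertexOfK (limMKerOf fun j => unitK (sf j) (sm j) (coDressKBmAt (toSite r) Lc (KInvStep (d := 3) Lc j))) Lc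
          (limStOf fun j => unitS (sf j) (sm j) (Sfl j)))
        (limTabOf fun j => unitW (sf j) (sm j) (Wfl j))) μ ν = B12Normalization.stepBal N Lc := by
  have hδK : 0 < δK := by linarith
  obtain ⟨c, -, hG, hGall⟩ :=
    exists_coDressedBm_unit_rows hLc hr sf sm hsf hsm (K := fun j => KInvStep (d := 3) Lc j) hδK hK hKall
  exact d1Drift_JsBalBmAn1At_iff_of_cauchy_codressedBm_unit hLc hr cE cVH cΛ cE₂ cB T Sfl Wfl sf sm hSfl hWfl hsf hsm hG hGall hS hSall hW
    hWall hR hRK hRS hRW hθ0 hθ1 μ ν N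

end WallV223

/-! ## §6 The CENTRED candidate `SpineRooted.JsBalBmAn1AtCtr hLc` (root `ctrOff 4 Lc`; the root of an2's `hR` wiring) -/

section Centred

variable {Lc : ℕ} [NeZero Lc] (hLc : 1 ≤ Lc) (cE cVH cΛ cE₂ cB : ℝ) (T : Fin 4 → Fin 4 → Fin 4 → Fin 4 → ℝ)
  (Sfl : ℕ → Fin (3 + 1) → (Fin (3 + 1) → ℤ) → MKer (3 + 1) (Fib 3))
  (Wfl : ℕ → Fin (3 + 1) → (Fin (3 + 1) → ℤ) → Fin (3 + 1) → (Fin (3 + 1) → ℤ) → MKer (3 + 1) (Fib 3)) (sf sm : ℕ → ℝ)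
  {W₀ : ℕ → Fin (3 + 1) → (Fin (3 + 1) → ℤ) → Fin (3 + 1) → (Fin (3 + 1) → ℤ) → MKer (3 + 1) (Fib 3)} {Cw₀ δw₀ : ℕ → ℝ}
  {hδw₀ : ∀ j, 0 < δw₀ j} {hW₀ : ∀ j, VertexFamily₂ (W₀ j) Lc (Cw₀ j) (δw₀ j)} {R C cK δK Cs cS δS Cw cW δW θ : ℝ}
  (hSfl : ∀ j, (JsBal0AtOf hLc (ctrOff_mem_box hLc) cE cVH cΛ W₀ Cw₀ δw₀ hδw₀ hW₀ j).S = Sfl j)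
  (hWfl : ∀ j, WbalAtOf 3 Lc (toSite (ctrOff 4 Lc)) cE cVH cΛ
    (T2AtOf 3 Lc (toSite (ctrOff 4 Lc)) cE cVH cΛ cE₂ cB T (vh₂SAt (toSite (ctrOff 4 Lc)) Lc) (mixFFAt (toSite (ctrOff 4 Lc)) Lc))
      (mixFFAt (toSite (ctrOff 4 Lc)) Lc) j = Wfl j)
  (hsf : ∀ j, sf j ≠ 0) (hsm : ∀ j, sm j ≠ 0)
include hSfl hWfl hsf hsm

/-- [folklore] **THE CENTRED WALL CANDIDATE v2.23 ⟺ THE EXPLICIT IDENTIFICATION AT THE CONSTRUCTED LIMITS** — §4 at the root `r = ctrOff 4 Lc`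
(`JsBalBmAn1AtCtr_eq`, `rfl`); K-rows on `D_j (coDressKBmAt (toSite (ctrOff 4 Lc)) Lc (KInvStep Lc j)) D_j`, the resolvents of an2's centred `hR`
wiring.  Discharges NOTHING; `Odd Lc` is NOT needed here (it enters only an2's reflection side condition). -/
theorem d1Drift_JsBalBmAn1AtCtr_iff_of_cauchy_codressedBm_unit
    (hG : ∀ j, Decays (unitK (sf j) (sm j) (coDressKBmAt (toSite (ctrOff 4 Lc)) Lc (KInvStep (d := 3) Lc j))) C δK)
    (hGall : ∀ k j, Decays (unitK (sf (k + j)) (sm (k + j)) (coDressKBmAt (toSite (ctrOff 4 Lc)) Lc (KInvStep (d := 3) Lc (k + j))) -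
      unitK (sf k) (sm k) (coDressKBmAt (toSite (ctrOff 4 Lc)) Lc (KInvStep (d := 3) Lc k))) (cK * θ ^ k) δK)
    (hS : ∀ j, LocStencil (unitS (sf j) (sm j) (Sfl j)) Cs δS)
    (hSall : ∀ k j, LocStencil (unitS (sf (k + j)) (sm (k + j)) (Sfl (k + j)) - unitS (sf k) (sm k) (Sfl k)) (cS * θ ^ k) δS)
    (hW : ∀ j, VertexFamily₂ (unitW (sf j) (sm j) (Wfl j)) Lc Cw δW)
    (hWall : ∀ k j, VertexFamily₂ (unitW (sf (k + j)) (sm (k + j)) (Wfl (k + j)) - unitW (sf k) (sm k) (Wfl k)) Lc (cW * θ ^ k) δW)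
    (hR : 0 < R) (hRK : R < δK) (hRS : R / 2 < δS) (hRW : R < δW) (hθ0 : 0 ≤ θ) (hθ1 : θ < 1) (μ ν : Fin 4) (N : ℝ) :
    D1Drift Lc (JsBalBmAn1AtCtr hLc cE cVH cΛ cE₂ cB T) N μ ν ↔
      B12Beta.secondMoment (hessKer (limMKerOf fun j => unitK (sf j) (sm j) (coDressKBmAt (toSite (ctrOff 4 Lc)) Lc (KInvStep (d := 3) Lc j)))
        (vertexOfK (limMKerOf fun j => unitK (sf j) (sm j) (coDressKBmAt (toSite (ctrOff 4 Lc)) Lc (KInvStep (d := 3) Lc j))) Lc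
          (limStOf fun j => unitS (sf j) (sm j) (Sfl j)))
        (limTabOf fun j => unitW (sf j) (sm j) (Wfl j))) μ ν = B12Normalization.stepBal N Lc := by
  rw [JsBalBmAn1AtCtr_eq]
  exact d1Drift_JsBalBmAn1At_iff_of_cauchy_codressedBm_unit hLc (ctrOff_mem_box hLc) cE cVH cΛ cE₂ cB T Sfl Wfl sf sm hSfl hWfl hsf hsm hG
    hGall hS hSall hW hWall hR hRK hRS hRW hθ0 hθ1 μ ν N

end Centred

end

end Summit.QuantumFields.BalabanUV.Beta.HessKerCoDressedBmWall
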